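import Summits.ValiantsHypothesis.ValiantsHypothesis.Theorems.KPlusLogSqLawTropicalGradedPages

/-!
# Route «KPlusLogSqLaw», crux `WeakLifting` (stmt-ValiantsHypothesis-19561), docket D2 — BAND RIGIDITY and GRADED ROWS:
# the lex rigidity law for an arbitrary class LEVEL with the «rest» confined to a band, and the resulting LEVEL GRADING of the union support

HONEST FRAMING.  Helper file (cell `pub-symmetroid`, seat val-sym-lift-p3 g25, 2026-08-29) `--supports` the crux
`Summit.ValiantsHypothesis.ValiantsHypothesis.Theses.KPlusLogSqLaw.WeakLifting` (ledger item `stmt-ValiantsHypothesis-19561`, route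
`KPlusLogSqLaw`; lineage docket D2 = the `K = 4` tropical exponent fork).  It completes requirement R3 of the lineage memo
HOME/val-sym-lift-p3/g4/K4-PAGE-RIGIDITY-AND-CARRIES.md §3–4 («every page's union support is GRADED for the top class; every row's for class 2»):
the page half is `GradedPages.exists_grading`; this file is the general BAND law from which the ROW half follows (companion file
`…TropicalGradedRows`).  STRUCTURE laws for dominant terms of an
ARBITRARY design; they decide nothing about the fork and assert nothing about `WeakLifting`, `TropicalB`, `Lifting`, `KPlusLogSqLaw`,
`MatrixDescartes` (stmt-ValiantsHypothesis-18050) or VP ≠ VNP.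

CONTENT (namespace `…Theorems.KPlusLogSqLaw.BandRigidity`).  A class LEVEL is any `φ : Fin K → ℤ`; the level of a term `p` is
`Σ_i φ (p.2 i)`, its REST at scale `E` is `slope d p − E·Σ_i φ (p.2 i)`.
* `level_eq_of_redecomp_band` — BAND RIGIDITY (`k` terms): if `t₀..t_{k−1}` are dominant at strictly increasing slopes with equal level `c`,
  `u₀..u_{k−1}` is a columnwise re-decomposition, the rests of all `t_r, u_r` lie in one band `[R₀, R₀ + W]` and `(k/2)·W ≤ E`, `0 ≤ E`, then
  every `u_r` has level `c`.  (The tree's `classCount_eq_of_redecomp`, p493748, is the case `φ = [· = l⋆]`, `E = d l⋆`, band `[0, m·D]`; the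
  proof is the same Abel summation against the exchange lemma `sum_mul_slope_lt_of_redecomp`, with the band replacing the exponent bound.)
* `level_eq_of_recombination_band` — perfect-matching form (König, as in p494347): every term choosing in each column an entry of the `t`'s
  with bijective rows has level `c`, provided the band holds for all such recombined terms.
* `level_eq_of_same_position`, `exists_levelGrading` — the level is a property of the POSITION, and (Birkhoff-face lemma, p721993) it is an
  integer row + column potential on the union support: `φ ((t r).2 i) = α ((t r).1 i) + β i`.
* The ROW application (GRADED ROWS: the second class of a strongly-lex design is a potential inside each row) is the companion file
  `…TropicalGradedRows` (`BandRigidity.row_band`, `classCount_two_eq_of_recombination`, `exists_rowGrading`).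
[folklore: LP duality / majorization; the packaging is the cell's]
-/

set_option linter.dupNamespace false
set_option autoImplicit false

namespace Summit.ValiantsHypothesis.ValiantsHypothesis.Theorems.KPlusLogSqLaw

open Summit.ValiantsHypothesis.ValiantsHypothesis.Theorems.MatrixDescartes.Negative
open Summit.ValiantsHypothesis.ValiantsHypothesis.Theorems.LacunarySymmetroidMatrixDescartes.TropicalCensus
open scoped BigOperators
open Finset

namespace BandRigidity

variable {m K : ℕ}

/-- **BAND RIGIDITY (`k`-term law).**  Terms `t₀..t_{k−1}` dominant at strictly increasing slopes with equal `φ`-level `c`; `u` a columnwise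
re-decomposition; all rests `slope − E·level` of the `t`'s and `u`'s in one band of width `W` with `(k/2)·W ≤ E`, `0 ≤ E`: then every `u_r`
has level `c`. [folklore] -/
theorem level_eq_of_redecomp_band {k : ℕ} (d : Fin K → ℕ) (v ε : Fin m → Fin m → Fin K → ℤ)
    (θ : Fin k → ℤ) (hθ : StrictMono θ) (t u : Fin k → Equiv.Perm (Fin m) × (Fin m → Fin K))
    (hdom : ∀ r, IsDominant d v ε (θ r) (t r))
    (hcol : ∀ i : Fin m, (univ : Finset (Fin k)).val.map (fun r => ((u r).1 i, (u r).2 i)) =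
      (univ : Finset (Fin k)).val.map (fun r => ((t r).1 i, (t r).2 i)))
    (φ : Fin K → ℤ) (E R₀ W : ℤ) (hE : 0 ≤ E) (hlex : (((k / 2 : ℕ)) : ℤ) * W ≤ E)
    (hband_t : ∀ r, R₀ ≤ slope d (t r) - E * ∑ i, φ ((t r).2 i) ∧ slope d (t r) - E * ∑ i, φ ((t r).2 i) ≤ R₀ + W)
    (hband_u : ∀ r, R₀ ≤ slope d (u r) - E * ∑ i, φ ((u r).2 i) ∧ slope d (u r) - E * ∑ i, φ ((u r).2 i) ≤ R₀ + W)
    (c : ℤ) (hc : ∀ r, ∑ i, φ ((t r).2 i) = c) :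
    ∀ r, ∑ i, φ ((u r).2 i) = c := by
  classical
  rcases Nat.eq_zero_or_pos k with hk | hk
  · subst hk; intro r; exact Fin.elim0 r
  obtain ⟨n, rfl⟩ : ∃ n, k = n + 1 := ⟨k - 1, by omega⟩
  set cnt : (Equiv.Perm (Fin m) × (Fin m → Fin K)) → ℤ := fun p => ∑ i, φ (p.2 i) with hcnt
  by_contra hne
  push Not at hne
  obtain ⟨r₀, hr₀⟩ := hne
  -- sort the u's by their levels
  let f : Fin (n + 1) → ℤ := fun r => cnt (u r)
  let π : Equiv.Perm (Fin (n + 1)) := Tuple.sort f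
  have hmono : Monotone (f ∘ π) := Tuple.monotone_sort f
  let u' : Fin (n + 1) → Equiv.Perm (Fin m) × (Fin m → Fin K) := fun r => u (π r)
  have hcol' : ∀ i : Fin m, (univ : Finset (Fin (n + 1))).val.map (fun r => ((u' r).1 i, (u' r).2 i)) =
      (univ : Finset (Fin (n + 1))).val.map (fun r => ((t r).1 i, (t r).2 i)) := by
    intro i; rw [← hcol i]; exact pageRigid_colMultiset_comp_equiv u π i
  -- excesses
  let e : Fin (n + 1) → ℤ := fun r => cnt (u' r) - c
  have hemono : Monotone e := fun a b hab => by
    show cnt (u (π a)) - c ≤ cnt (u (π b)) - c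
    have := hmono hab; simp only [Function.comp, f] at this; linarith
  have htot : ∑ r, cnt (u r) = ∑ r, cnt (t r) := by
    simp only [hcnt]
    exact pageRigid_sum_colfun_eq_of_redecomp t u hcol (fun _ l => φ l)
  have htot' : ∑ r, cnt (u' r) = ∑ r, cnt (u r) := Equiv.sum_comp π (fun r => cnt (u r))
  have hesum : ∑ r, e r = 0 := by
    show ∑ r, (cnt (u' r) - c) = 0
    rw [sum_sub_distrib, htot', htot]
    simp [hcnt, hc]
  have hene : ∃ r, e r ≠ 0 := by
    refine ⟨π.symm r₀, ?_⟩
    show cnt (u (π (π.symm r₀))) - c ≠ 0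
    rw [Equiv.apply_symm_apply]
    intro h
    apply hr₀
    have : cnt (u r₀) = c := by linarith
    simpa only [hcnt] using this
  have hune : u' ≠ t := by
    intro h
    obtain ⟨r, hr⟩ := hene
    apply hr
    show cnt (u' r) - c = 0
    rw [h]; simp [hcnt, hc]
  -- the exchange lemma
  have hlt := sum_mul_slope_lt_of_redecomp d v ε θ t u' hdom hcol' hune
  -- slopes split as E·level + rest
  set rest : (Equiv.Perm (Fin m) × (Fin m → Fin K)) → ℤ := fun p => slope d p - E * cnt p with hrest
  have hsl : ∀ p : Equiv.Perm (Fin m) × (Fin m → Fin K), slope d p = E * cnt p + rest p := by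
    intro p; simp only [hrest]; ring
  have hbu' : ∀ r, R₀ ≤ rest (u' r) ∧ rest (u' r) ≤ R₀ + W := fun r => hband_u (π r)
  have hbt : ∀ r, R₀ ≤ rest (t r) ∧ rest (t r) ≤ R₀ + W := fun r => hband_t r
  have hW0 : 0 ≤ W := by have := hbt 0; linarith [this.1, this.2]
  -- the difference sequence
  let x : Fin (n + 1) → ℤ := fun r => slope d (u' r) - slope d (t r)
  let y : Fin (n + 1) → ℤ := fun r => rest (u' r) - rest (t r)
  have hxy : ∀ r, x r = E * e r + y r := by
    intro r
    show slope d (u' r) - slope d (t r) = E * (cnt (u' r) - c) + (rest (u' r) - rest (t r))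
    rw [hsl, hsl]
    have : cnt (t r) = c := by simp only [hcnt, hc]
    rw [this]; ring
  have hslopetot : ∑ r, slope d (u' r) = ∑ r, slope d (t r) := by
    unfold LacunarySymmetroidMatrixDescartes.TropicalCensus.slope
    exact pageRigid_sum_colfun_eq_of_redecomp t u' hcol' (fun _ l => (d l : ℤ))
  have hxsum : ∑ r, x r = 0 := by
    show ∑ r, (slope d (u' r) - slope d (t r)) = 0
    rw [sum_sub_distrib, hslopetot]; ring
  have hysum : ∑ r, y r = 0 := by
    have : ∑ r, x r = E * ∑ r, e r + ∑ r, y r := by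
      rw [mul_sum, ← sum_add_distrib]; exact sum_congr rfl fun r _ => hxy r
    rw [hxsum, hesum, mul_zero, zero_add] at this
    exact this.symm
  have hyB : ∀ r, -W ≤ y r ∧ y r ≤ W := by
    intro r
    constructor
    · show -W ≤ rest (u' r) - rest (t r); linarith [(hbu' r).1, (hbt r).2]
    · show rest (u' r) - rest (t r) ≤ W; linarith [(hbu' r).2, (hbt r).1]
  -- suffix sums of x are nonnegative
  have htail : ∀ j : Fin (n + 1), j ≠ 0 → 0 ≤ ∑ r, (if j ≤ r then x r else 0) := by
    intro j hj
    have hj' : (j : ℕ) ≠ 0 := fun h => hj (Fin.ext h)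
    have h1 := pageRigid_suffix_pos e hemono hesum hene j hj'
    have h2 := pageRigid_suffix_ge y W hyB hysum j
    have hsplit : ∑ r, (if j ≤ r then x r else 0)
        = E * ∑ r, (if j ≤ r then e r else 0) + ∑ r, (if j ≤ r then y r else 0) := by
      rw [mul_sum, ← sum_add_distrib]
      refine sum_congr rfl fun r _ => ?_
      split_ifs <;> simp [hxy]
    rw [hsplit]
    have hmin : ((min (j : ℕ) (n + 1 - j) : ℕ) : ℤ) ≤ (((n + 1) / 2 : ℕ) : ℤ) := by
      have : min (j : ℕ) (n + 1 - (j : ℕ)) ≤ (n + 1) / 2 := by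
        have hjlt : (j : ℕ) < n + 1 := j.isLt
        rcases le_total (j : ℕ) (n + 1 - j) with h | h
        · rw [min_eq_left h]; omega
        · rw [min_eq_right h]; omega
      exact_mod_cast this
    nlinarith
  -- Abel: Σ (θ r − θ 0) x r ≥ 0, i.e. Σ θ r x r ≥ 0, contradicting the exchange lemma
  have habel := pageRigid_abel_nonneg n θ x hθ.monotone htail
  have hzero : ∑ r, (θ r - θ 0) * x r = ∑ r, θ r * x r := by
    have : ∑ r, (θ r - θ 0) * x r = ∑ r, θ r * x r - θ 0 * ∑ r, x r := by
      rw [mul_sum, ← sum_sub_distrib]; exact sum_congr rfl fun r _ => by ring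
    rw [this, hxsum, mul_zero, sub_zero]
  have hsum_x : ∑ r, θ r * x r = ∑ r, θ r * slope d (u' r) - ∑ r, θ r * slope d (t r) := by
    rw [← sum_sub_distrib]; exact sum_congr rfl fun r _ => by show θ r * (slope d (u' r) - slope d (t r)) = _; ring
  rw [hzero, hsum_x] at habel
  linarith

/-- **BAND RIGIDITY, perfect-matching form.**  Under the band hypothesis for every term recombined columnwise from the `t`'s, every term
choosing in each column an entry of the `t`'s with bijective rows has level `c` (König re-assembly of the leftover, as in p494347). [folklore] -/
theorem level_eq_of_recombination_band {k : ℕ} (d : Fin K → ℕ) (v ε : Fin m → Fin m → Fin K → ℤ)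
    (θ : Fin k → ℤ) (hθ : StrictMono θ) (t : Fin k → Equiv.Perm (Fin m) × (Fin m → Fin K))
    (hdom : ∀ r, IsDominant d v ε (θ r) (t r))
    (φ : Fin K → ℤ) (E R₀ W : ℤ) (hE : 0 ≤ E) (hlex : (((k / 2 : ℕ)) : ℤ) * W ≤ E)
    (hband : ∀ p : Equiv.Perm (Fin m) × (Fin m → Fin K),
      (∀ i, ∃ r, ((t r).1 i, (t r).2 i) = (p.1 i, p.2 i)) →
      R₀ ≤ slope d p - E * ∑ i, φ (p.2 i) ∧ slope d p - E * ∑ i, φ (p.2 i) ≤ R₀ + W)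
    (c : ℤ) (hc : ∀ r, ∑ i, φ ((t r).2 i) = c) (hk : 0 < k)
    (sel : Fin m → Fin k) (hbij : Function.Bijective fun i => (t (sel i)).1 i) :
    ∑ i, φ ((t (sel i)).2 i) = c := by
  classical
  obtain ⟨n, rfl⟩ : ∃ n, k = n + 1 := ⟨k - 1, by omega⟩
  -- the layers and their regularity (as in `classCount_eq_of_recombination`)
  let e : Fin (n + 1) → Fin m → Fin m × Fin K := fun j i => ((t j).1 i, (t j).2 i)
  have hreg : ∀ a : Fin m, ((univ : Finset (Fin (n + 1) × Fin m)).filter fun p => (e p.1 p.2).1 = a).card = n + 1 := by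
    intro a
    have h : ((univ : Finset (Fin (n + 1) × Fin m)).filter fun p => (e p.1 p.2).1 = a)
        = (univ : Finset (Fin (n + 1))).image (fun j => (j, ((t j).1).symm a)) := by
      ext p
      simp only [mem_filter, mem_univ, true_and, mem_image, e]
      constructor
      · intro hp
        refine ⟨p.1, ?_⟩
        have : ((t p.1).1).symm a = p.2 := by rw [← hp]; simp
        rw [this]
      · rintro ⟨j, rfl⟩
        simp
    rw [h, card_image_of_injective _ (fun j j' hjj' => (Prod.mk.inj hjj').1)]
    simp
  have hbij' : Function.Bijective fun i => (e (sel i) i).1 := hbij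
  let e' : Fin n → Fin m → Fin m × Fin K := fun j i => e ((sel i).succAbove j) i
  have hreg' := pageRigid_leftover_regular e hreg sel hbij'
  obtain ⟨u', hu'⟩ := pageRigid_konig n e' hreg'
  let M : Equiv.Perm (Fin m) × (Fin m → Fin K) := (Equiv.ofBijective _ hbij, fun i => (t (sel i)).2 i)
  let U : Fin (n + 1) → Equiv.Perm (Fin m) × (Fin m → Fin K) := Fin.cons M u'
  have hcol : ∀ i : Fin m, (univ : Finset (Fin (n + 1))).val.map (fun r => ((U r).1 i, (U r).2 i)) =
      (univ : Finset (Fin (n + 1))).val.map (fun r => ((t r).1 i, (t r).2 i)) := by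
    intro i
    have hL : (univ : Finset (Fin (n + 1))).val.map (fun r => ((U r).1 i, (U r).2 i))
        = e (sel i) i ::ₘ (univ : Finset (Fin n)).val.map (fun j => e' j i) := by
      rw [Fin.univ_succ, cons_val, Multiset.map_cons, map_val, Multiset.map_map]
      congr 1
      rw [← hu' i]
      rfl
    have hR : (univ : Finset (Fin (n + 1))).val.map (fun r => ((t r).1 i, (t r).2 i))
        = e (sel i) i ::ₘ (univ : Finset (Fin n)).val.map (fun j => e' j i) := by
      rw [Fin.univ_succAbove n (sel i), cons_val, Multiset.map_cons, map_val, Multiset.map_map]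
      rfl
    rw [hL, hR]
  -- every member of the re-decomposition is recombined from the `t`'s, hence in the band
  have hband_u : ∀ r, R₀ ≤ slope d (U r) - E * ∑ i, φ ((U r).2 i) ∧ slope d (U r) - E * ∑ i, φ ((U r).2 i) ≤ R₀ + W := by
    intro r
    refine hband (U r) fun i => ?_
    have hmem : ((U r).1 i, (U r).2 i) ∈ (univ : Finset (Fin (n + 1))).val.map (fun r => ((t r).1 i, (t r).2 i)) := by
      rw [← hcol i]
      exact Multiset.mem_map_of_mem _ (mem_univ_val r)
    obtain ⟨r', -, hr'⟩ := Multiset.mem_map.mp hmem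
    exact ⟨r', hr'⟩
  have hband_t : ∀ r, R₀ ≤ slope d (t r) - E * ∑ i, φ ((t r).2 i) ∧ slope d (t r) - E * ∑ i, φ ((t r).2 i) ≤ R₀ + W :=
    fun r => hband (t r) fun i => ⟨r, rfl⟩
  have hall := level_eq_of_redecomp_band d v ε θ hθ t U hdom hcol φ E R₀ W hE hlex hband_t hband_u c hc 0
  simpa [U, M] using hall

/-- **The level is a property of the position.**  Two of the `t`'s through the same position carry classes of equal level there. -/
theorem level_eq_of_same_position {k : ℕ} (d : Fin K → ℕ) (v ε : Fin m → Fin m → Fin K → ℤ)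
    (θ : Fin k → ℤ) (hθ : StrictMono θ) (t : Fin k → Equiv.Perm (Fin m) × (Fin m → Fin K))
    (hdom : ∀ r, IsDominant d v ε (θ r) (t r))
    (φ : Fin K → ℤ) (E R₀ W : ℤ) (hE : 0 ≤ E) (hlex : (((k / 2 : ℕ)) : ℤ) * W ≤ E)
    (hband : ∀ p : Equiv.Perm (Fin m) × (Fin m → Fin K),
      (∀ i, ∃ r, ((t r).1 i, (t r).2 i) = (p.1 i, p.2 i)) →
      R₀ ≤ slope d p - E * ∑ i, φ (p.2 i) ∧ slope d p - E * ∑ i, φ (p.2 i) ≤ R₀ + W)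
    (c : ℤ) (hc : ∀ r, ∑ i, φ ((t r).2 i) = c) (hk : 0 < k)
    (r r' : Fin k) (i : Fin m) (hpos : (t r').1 i = (t r).1 i) :
    φ ((t r).2 i) = φ ((t r').2 i) := by
  classical
  let sel : Fin m → Fin k := Function.update (fun _ => r) i r'
  have hrow : (fun j => (t (sel j)).1 j) = fun j => (t r).1 j := by
    funext j
    by_cases hj : j = i
    · subst hj; simp [sel, hpos]
    · simp [sel, Function.update_of_ne hj]
  have hbij : Function.Bijective fun j => (t (sel j)).1 j := by
    rw [hrow]; exact (t r).1.bijective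
  have hcsel := level_eq_of_recombination_band d v ε θ hθ t hdom φ E R₀ W hE hlex hband c hc hk sel hbij
  have hupd := sum_update_arg (fun j s => φ ((t s).2 j)) (fun _ => r) i r'
  have h1 : ∑ j, φ ((t (sel j)).2 j) = ∑ j, φ ((t r).2 j) - φ ((t r).2 i) + φ ((t r').2 i) := hupd
  rw [hcsel, hc r] at h1
  linarith

/-- **GRADED LEVELS.**  Under the band hypothesis for recombined terms, the level of the class at a position of the union support of the
`t`'s is an integer row + column potential: `φ ((t r).2 i) = α ((t r).1 i) + β i`. -/
theorem exists_levelGrading {k : ℕ} (d : Fin K → ℕ) (v ε : Fin m → Fin m → Fin K → ℤ)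
    (θ : Fin k → ℤ) (hθ : StrictMono θ) (t : Fin k → Equiv.Perm (Fin m) × (Fin m → Fin K))
    (hdom : ∀ r, IsDominant d v ε (θ r) (t r))
    (φ : Fin K → ℤ) (E R₀ W : ℤ) (hE : 0 ≤ E) (hlex : (((k / 2 : ℕ)) : ℤ) * W ≤ E)
    (hband : ∀ p : Equiv.Perm (Fin m) × (Fin m → Fin K),
      (∀ i, ∃ r, ((t r).1 i, (t r).2 i) = (p.1 i, p.2 i)) →
      R₀ ≤ slope d p - E * ∑ i, φ (p.2 i) ∧ slope d p - E * ∑ i, φ (p.2 i) ≤ R₀ + W)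
    (c : ℤ) (hc : ∀ r, ∑ i, φ ((t r).2 i) = c) (hk : 0 < k) :
    ∃ α β : Fin m → ℤ, ∀ (r : Fin k) (i : Fin m), φ ((t r).2 i) = α ((t r).1 i) + β i := by
  classical
  let P : Fin m → Fin m → Prop := fun a i => ∃ r, (t r).1 i = a
  let w : Fin m → Fin m → ℤ := fun a i => if h : ∃ r, (t r).1 i = a then φ ((t h.choose).2 i) else 0
  have hw : ∀ (r : Fin k) (i : Fin m), w ((t r).1 i) i = φ ((t r).2 i) := by
    intro r i
    have hex : ∃ r', (t r').1 i = (t r).1 i := ⟨r, rfl⟩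
    simp only [w, dif_pos hex]
    exact (level_eq_of_same_position d v ε θ hθ t hdom φ E R₀ W hE hlex hband c hc hk r hex.choose i hex.choose_spec).symm
  have hconstc : ∀ σ : Equiv.Perm (Fin m), (∀ i, P (σ i) i) → ∑ i, w (σ i) i = c := by
    intro σ hσ
    choose sel hsel using hσ
    have hbij : Function.Bijective fun j => (t (sel j)).1 j := by
      have : (fun j => (t (sel j)).1 j) = σ := funext hsel
      rw [this]; exact σ.bijective
    have hcsel := level_eq_of_recombination_band d v ε θ hθ t hdom φ E R₀ W hE hlex hband c hc hk sel hbij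
    rw [← hcsel]
    exact sum_congr rfl fun i _ => by rw [← hsel i]; exact hw (sel i) i
  let r₀ : Fin k := ⟨0, hk⟩
  have hσ₀ : ∀ i, P ((t r₀).1 i) i := fun i => ⟨r₀, rfl⟩
  have hconst : ∀ σ : Equiv.Perm (Fin m), (∀ i, P (σ i) i) → ∑ i, w (σ i) i = ∑ i, w ((t r₀).1 i) i := by
    intro σ hσ; rw [hconstc σ hσ, hconstc _ hσ₀]
  obtain ⟨α, β, h⟩ := BirkhoffFace.exists_potential_of_sum_const P w (t r₀).1 hσ₀ hconst
  refine ⟨α, β, fun r i => ?_⟩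
  rw [← hw r i]
  exact h (t r).1 (fun j => ⟨r, rfl⟩) i

end BandRigidity

end Summit.ValiantsHypothesis.ValiantsHypothesis.Theorems.KPlusLogSqLaw
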